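import Mathlib
import HarnessLib.Audit
import Summits.PneNP.PneNP.Theorems.PstarNorCoreTools

/-!
# Sparse AND-sharing in XOR-closed cores (ROUND-24, memo `CORE-BOUND-NOTES.md` §12.1; GAPTWO-PLAN v1.1, conjecture C6 roadmap)

FRONTIER range-avoidance ladder, rung F-N3, ROUND 24 (cell `pnp-ideate`, planner memo `r24/CORE-BOUND-NOTES.md` §12.1 "the core alone is almost
sharing-free"; restricted-model proof complexity — nothing here bears on `P` versus `NP`).

Let `J₀` be an XOR-closed set of `k` outputs (`PstarCoreBound.XorClosed`: no XOR-slot variable of `J₀` is a boundary variable of `J₀`) on an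
`(r, 3/2)`-boundary-expanding instance with `k ≤ r`.  An AND SLOT of `J₀` is a pair `(j, s)` with `j ∈ J₀`, `s ∈ {2, 3}`; it is PRIVATE if its
variable lies in `bdry I J₀` and SHARED otherwise.  The XOR side contributes nothing to `bdry I J₀`, so:

* `card_bdry_le_private`      — `#bdry I J₀ ≤ #private AND slots`;
* `three_mul_card_le`         — `3k ≤ 2 · #private AND slots`;
* `two_mul_card_shared_le`    — **at most `k/2` shared AND slots**: `2 · #shared ≤ k`;
* `four_mul_card_sharedVars_le` (typed instances) — every shared AND variable fills at least two shared AND slots, so **at most `k/4` shared AND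
  variables**: `4 · #sharedVars ≤ k`;
* `four_mul_card_noPrivate_le` — at most `k/4` outputs of `J₀` have no private AND slot;
* `private_and_of_card_le_seven` (pure typed, `k ≤ 7`) — EVERY output of `J₀` keeps a private AND variable (Assumption A of the memo is automatic:
  at most one shared AND variable, which slot-injectivity keeps out of one of the two slots of every output);
* `and_private_of_card_le_three` (typed, `k ≤ 3`) — no AND-sharing at all inside `J₀` (the triangle core `CONS-T`).

Readouts of memo §12.1 (`k = 3`: none shared; `k = 5`: at most `2` shared slots = one variable twice; `k = 6, 7`: at most `3` slots = one variable;
`k = 8`: at most `4` slots) are the instances of `two_mul_card_shared_le` / `four_mul_card_sharedVars_le`.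
-/

set_option linter.dupNamespace false -- `Summit.PneNP.PneNP.…`: summit = sub-problem name (D-0017 single-conjunct layout)

open Finset Literature.Computability.Complexity
open Summit.PneNP.PneNP.Theorems.PstarTyped (Typed)
open Summit.PneNP.PneNP.Theorems.PstarSALevel (varSet bdry BoundaryExpanding)
open Summit.PneNP.PneNP.Theorems.PstarCentreFree (vars_mem_varSet)
open Summit.PneNP.PneNP.Theorems.PstarGapOneKills (exists_other_reader)
open Summit.PneNP.PneNP.Theorems.PstarCoreBound (XorClosed)

namespace Summit.PneNP.PneNP.Theorems.PstarCoreSharing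

variable {n m : ℕ}

-- Throughout: AND slots of `J₀` = `J₀ ×ˢ {s : Fin 4 | 2 ≤ s}`; PRIVATE = variable in `bdry I J₀`, SHARED = not.

/-- There are exactly two AND slot positions. -/
private theorem card_andPos : ((univ : Finset (Fin 4)).filter fun s => 2 ≤ s.val).card = 2 := by decide

/-- `J₀` has `2k` AND slots. -/
theorem card_andSlots (J₀ : Finset (Fin m)) : (J₀ ×ˢ ((univ : Finset (Fin 4)).filter fun s => 2 ≤ s.val)).card = 2 * J₀.card := by
  rw [card_product, card_andPos, mul_comm]

/-- Private plus shared AND slots number `2k`. -/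
theorem card_private_add_card_shared (I : LocalMap 4 n m) (J₀ : Finset (Fin m)) :
    ((J₀ ×ˢ ((univ : Finset (Fin 4)).filter fun s => 2 ≤ s.val)).filter fun p => I.vars p.1 p.2 ∈ bdry I J₀).card +
      ((J₀ ×ˢ ((univ : Finset (Fin 4)).filter fun s => 2 ≤ s.val)).filter fun p => I.vars p.1 p.2 ∉ bdry I J₀).card = 2 * J₀.card := by
  rw [card_filter_add_card_filter_not, card_andSlots]

/-- **The boundary of an XOR-closed family is carried by its private AND slots.** -/
theorem card_bdry_le_private (I : LocalMap 4 n m) {J₀ : Finset (Fin m)} (hx : XorClosed I J₀) :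
    (bdry I J₀).card ≤ ((J₀ ×ˢ ((univ : Finset (Fin 4)).filter fun s => 2 ≤ s.val)).filter fun p => I.vars p.1 p.2 ∈ bdry I J₀).card := by
  classical
  have hcov : bdry I J₀ ⊆
      (((J₀ ×ˢ ((univ : Finset (Fin 4)).filter fun s => 2 ≤ s.val)).filter fun p => I.vars p.1 p.2 ∈ bdry I J₀).image
        fun p => I.vars p.1 p.2) := by
    intro v hv
    have hv' := hv
    unfold PstarSALevel.bdry at hv'
    rw [mem_filter, card_eq_one] at hv'
    obtain ⟨j, hj⟩ := hv'.2
    have hjm : j ∈ J₀.filter fun j => v ∈ varSet I j := by rw [hj]; exact mem_singleton_self j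
    rw [mem_filter] at hjm
    obtain ⟨hjJ, hvj⟩ := hjm
    unfold PstarSALevel.varSet at hvj
    obtain ⟨s, -, hs⟩ := mem_image.1 hvj
    have h2 : 2 ≤ s.val := by
      by_contra hlt
      exact hx j hjJ s (by omega) (hs ▸ hv)
    exact mem_image.2 ⟨(j, s), mem_filter.2 ⟨mem_product.2 ⟨hjJ, mem_filter.2 ⟨mem_univ _, h2⟩⟩, hs ▸ hv⟩, hs⟩
  exact le_trans (card_le_card hcov) card_image_le

/-- **`3k ≤ 2 · #private AND slots`** under `(r, 3/2)`-boundary expansion. -/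
theorem three_mul_card_le (I : LocalMap 4 n m) {r : ℕ} (hB : BoundaryExpanding r I) {J₀ : Finset (Fin m)} (hk : J₀.card ≤ r)
    (hx : XorClosed I J₀) :
    3 * J₀.card ≤ 2 * ((J₀ ×ˢ ((univ : Finset (Fin 4)).filter fun s => 2 ≤ s.val)).filter fun p => I.vars p.1 p.2 ∈ bdry I J₀).card :=
  le_trans (hB J₀ hk) (Nat.mul_le_mul_left 2 (card_bdry_le_private I hx))

/-- **Memo §12.1: at most `k/2` shared AND slots in an XOR-closed core.** -/
theorem two_mul_card_shared_le (I : LocalMap 4 n m) {r : ℕ} (hB : BoundaryExpanding r I) {J₀ : Finset (Fin m)} (hk : J₀.card ≤ r)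
    (hx : XorClosed I J₀) :
    2 * ((J₀ ×ˢ ((univ : Finset (Fin 4)).filter fun s => 2 ≤ s.val)).filter fun p => I.vars p.1 p.2 ∉ bdry I J₀).card ≤ J₀.card := by
  have h1 := three_mul_card_le I hB hk hx
  have h2 := card_private_add_card_shared I J₀
  omega

/-! ## Typed instances: shared variables and outputs without a private slot -/

/-- On a typed instance a shared AND slot's variable fills a second shared AND slot (in another output of `J₀`). -/
theorem two_le_card_fibre (I : LocalMap 4 n m) (hT : Typed I) (J₀ : Finset (Fin m)) {p : Fin m × Fin 4}
    (hp : p ∈ (J₀ ×ˢ ((univ : Finset (Fin 4)).filter fun s => 2 ≤ s.val)).filter fun p => I.vars p.1 p.2 ∉ bdry I J₀) :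
    2 ≤ (((J₀ ×ˢ ((univ : Finset (Fin 4)).filter fun s => 2 ≤ s.val)).filter fun p => I.vars p.1 p.2 ∉ bdry I J₀).filter
      fun p' => I.vars p'.1 p'.2 = I.vars p.1 p.2).card := by
  classical
  rw [mem_filter, mem_product, mem_filter] at hp
  obtain ⟨⟨hj, -, hs⟩, hnb⟩ := hp
  obtain ⟨g, hg, hne, hv⟩ := exists_other_reader I hj (vars_mem_varSet I p.1 p.2) hnb
  unfold PstarSALevel.varSet at hv
  obtain ⟨s', -, hs'⟩ := mem_image.1 hv
  have h2 : 2 ≤ s'.val := by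
    by_contra hlt
    exact hT g p.1 s' p.2 (by omega) hs hs'
  have hgm : (g, s') ∈ (((J₀ ×ˢ ((univ : Finset (Fin 4)).filter fun s => 2 ≤ s.val)).filter fun p => I.vars p.1 p.2 ∉ bdry I J₀).filter
      fun p' => I.vars p'.1 p'.2 = I.vars p.1 p.2) :=
    mem_filter.2 ⟨mem_filter.2 ⟨mem_product.2 ⟨hg, mem_filter.2 ⟨mem_univ _, h2⟩⟩, by rw [hs']; exact hnb⟩, hs'⟩
  have hpm : p ∈ (((J₀ ×ˢ ((univ : Finset (Fin 4)).filter fun s => 2 ≤ s.val)).filter fun p => I.vars p.1 p.2 ∉ bdry I J₀).filter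
      fun p' => I.vars p'.1 p'.2 = I.vars p.1 p.2) :=
    mem_filter.2 ⟨mem_filter.2 ⟨mem_product.2 ⟨hj, mem_filter.2 ⟨mem_univ _, hs⟩⟩, hnb⟩, rfl⟩
  have hne' : (g, s') ≠ p := fun h => hne (congrArg Prod.fst h)
  exact one_lt_card.2 ⟨(g, s'), hgm, p, hpm, hne'⟩

/-- **At most `k/4` shared AND variables** (typed): `4 · #{variables of shared AND slots} ≤ k`. -/
theorem four_mul_card_sharedVars_le (I : LocalMap 4 n m) (hT : Typed I) {r : ℕ} (hB : BoundaryExpanding r I) {J₀ : Finset (Fin m)}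
    (hk : J₀.card ≤ r) (hx : XorClosed I J₀) :
    4 * (((J₀ ×ˢ ((univ : Finset (Fin 4)).filter fun s => 2 ≤ s.val)).filter fun p => I.vars p.1 p.2 ∉ bdry I J₀).image
      fun p => I.vars p.1 p.2).card ≤ J₀.card := by
  classical
  have h1 := two_mul_card_shared_le I hB hk hx
  have h2 : 2 * (((J₀ ×ˢ ((univ : Finset (Fin 4)).filter fun s => 2 ≤ s.val)).filter fun p => I.vars p.1 p.2 ∉ bdry I J₀).image
      fun p => I.vars p.1 p.2).card ≤
      ((J₀ ×ˢ ((univ : Finset (Fin 4)).filter fun s => 2 ≤ s.val)).filter fun p => I.vars p.1 p.2 ∉ bdry I J₀).card := by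
    refine mul_card_image_le_card (f := fun p : Fin m × Fin 4 => I.vars p.1 p.2) _ 2 fun v hv => ?_
    obtain ⟨p, hp, rfl⟩ := mem_image.1 hv
    exact two_le_card_fibre I hT J₀ hp
  omega

/-- **At most `k/4` outputs of `J₀` without a private AND slot.** -/
theorem four_mul_card_noPrivate_le (I : LocalMap 4 n m) {r : ℕ} (hB : BoundaryExpanding r I) {J₀ : Finset (Fin m)} (hk : J₀.card ≤ r)
    (hx : XorClosed I J₀) :
    4 * (J₀.filter fun j => I.vars j 2 ∉ bdry I J₀ ∧ I.vars j 3 ∉ bdry I J₀).card ≤ J₀.card := by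
  classical
  have h1 := two_mul_card_shared_le I hB hk hx
  have h2 : ((J₀.filter fun j => I.vars j 2 ∉ bdry I J₀ ∧ I.vars j 3 ∉ bdry I J₀) ×ˢ ({2, 3} : Finset (Fin 4))).card ≤
      ((J₀ ×ˢ ((univ : Finset (Fin 4)).filter fun s => 2 ≤ s.val)).filter fun p => I.vars p.1 p.2 ∉ bdry I J₀).card := by
    refine card_le_card fun p hp => ?_
    rw [mem_product, mem_filter, mem_insert, mem_singleton] at hp
    obtain ⟨⟨hj, h2, h3⟩, hs⟩ := hp
    refine mem_filter.2 ⟨mem_product.2 ⟨hj, mem_filter.2 ⟨mem_univ _, ?_⟩⟩, ?_⟩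
    · rcases hs with hs | hs <;> simp [hs]
    · rcases hs with hs | hs <;> rw [hs] <;> assumption
  rw [card_product] at h2
  have h3 : ({2, 3} : Finset (Fin 4)).card = 2 := by decide
  rw [h3] at h2
  omega

/-- **Assumption A is automatic for `k ≤ 7`** (pure typed): every output of an XOR-closed `J₀` with at most `7` outputs keeps a private AND
variable. -/
theorem private_and_of_card_le_seven (I : LocalMap 4 n m) (hI : I.IsPure xorAndPred) (hT : Typed I) {r : ℕ} (hB : BoundaryExpanding r I)
    {J₀ : Finset (Fin m)} (hk : J₀.card ≤ r) (hx : XorClosed I J₀) (h7 : J₀.card ≤ 7) :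
    ∀ j ∈ J₀, I.vars j 2 ∈ bdry I J₀ ∨ I.vars j 3 ∈ bdry I J₀ := by
  classical
  intro j hj
  by_contra hno
  push Not at hno
  obtain ⟨h2, h3⟩ := hno
  have hS := four_mul_card_sharedVars_le I hT hB hk hx
  -- both AND variables of `j` are shared and distinct: two shared variables, against `4 · #sharedVars ≤ 7`
  set S := ((J₀ ×ˢ ((univ : Finset (Fin 4)).filter fun s => 2 ≤ s.val)).filter fun p => I.vars p.1 p.2 ∉ bdry I J₀).image
      fun p => I.vars p.1 p.2 with hSdef
  have hm : ∀ s : Fin 4, 2 ≤ s.val → I.vars j s ∉ bdry I J₀ → I.vars j s ∈ S := fun s hs hnb =>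
    mem_image.2 ⟨(j, s), mem_filter.2 ⟨mem_product.2 ⟨hj, mem_filter.2 ⟨mem_univ _, hs⟩⟩, hnb⟩, rfl⟩
  have hne : I.vars j 2 ≠ I.vars j 3 := fun h => absurd (hI.2 j h) (by decide)
  have h2S := hm 2 (by decide) h2
  have h3S := hm 3 (by decide) h3
  have hcard : 2 ≤ S.card := one_lt_card.2 ⟨_, h2S, _, h3S, hne⟩
  omega

/-- **No AND-sharing in cores of at most `3` outputs** (typed): both AND variables of every output are private in `J₀`. -/
theorem and_private_of_card_le_three (I : LocalMap 4 n m) (hT : Typed I) {r : ℕ} (hB : BoundaryExpanding r I) {J₀ : Finset (Fin m)}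
    (hk : J₀.card ≤ r) (hx : XorClosed I J₀) (h3 : J₀.card ≤ 3) :
    ∀ j ∈ J₀, ∀ s : Fin 4, 2 ≤ s.val → I.vars j s ∈ bdry I J₀ := by
  classical
  intro j hj s hs
  by_contra hnb
  have h1 := two_mul_card_shared_le I hB hk hx
  have hp : (j, s) ∈ (J₀ ×ˢ ((univ : Finset (Fin 4)).filter fun s => 2 ≤ s.val)).filter fun p => I.vars p.1 p.2 ∉ bdry I J₀ :=
    mem_filter.2 ⟨mem_product.2 ⟨hj, mem_filter.2 ⟨mem_univ _, hs⟩⟩, hnb⟩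
  have h2 := le_trans (two_le_card_fibre I hT J₀ hp) (card_le_card (filter_subset _ _))
  omega

/-- **At most one shared AND variable when `k ≤ 7`** (typed). -/
theorem card_sharedVars_le_one (I : LocalMap 4 n m) (hT : Typed I) {r : ℕ} (hB : BoundaryExpanding r I) {J₀ : Finset (Fin m)}
    (hk : J₀.card ≤ r) (hx : XorClosed I J₀) (h7 : J₀.card ≤ 7) :
    (((J₀ ×ˢ ((univ : Finset (Fin 4)).filter fun s => 2 ≤ s.val)).filter fun p => I.vars p.1 p.2 ∉ bdry I J₀).image
      fun p => I.vars p.1 p.2).card ≤ 1 := by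
  have h := four_mul_card_sharedVars_le I hT hB hk hx
  omega

end Summit.PneNP.PneNP.Theorems.PstarCoreSharing
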